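import Literature.InformationTheory.QuantumCodes.QuantumExpanderCodes
import Literature.InformationTheory.QuantumCodes.HypergraphProductKernels
import HarnessLib

/-!
# Relabelling the qubits of a small-set-flip decoding problem (transport along an equivalence)

Topic `Literature/InformationTheory/QuantumCodes` (venture QEC). Theorem-only file (no definitions, no named
facts). The small-set-flip vocabulary of `QuantumExpanderCodes.lean` (`flipVec`, `genSupport`, `smallSets`,
`syndromeDecrease`, `IsSSFStep`, `SSFHalts`, `IsSSFRun`, `runOutput`, `IsSSFDecoder`), the tree's
`Decoder.Corrects` / `rowSpace` and `IsLocallyStochastic` are INVARIANT under a relabelling `e : Q ≃ Q'` of the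
qubits: a decoding problem with matrices `Hs'.submatrix id e`, `Hg'.submatrix id e` on `Q` is the problem
`Hs', Hg'` on `Q'` read through `e` (errors `x ↦ x ∘ e.symm`, flip sets `F ↦ F.map e`, decoders
`D ↦ (σ ↦ D σ ∘ e.symm)`, weights `μ ↦ (E' ↦ μ (E'.map e.symm))`).

Purpose: Fawzi–Grospellier–Leverrier 2018 treat one error type and say "the other case being symmetric"
(§2.3 p0008: "a decoding algorithm is given by an `X`-decoding algorithm … and a `Z`-decoding algorithm"); in
the tree the `Z`-sector of the quantum expander code `Q_G` IS the `X`-sector of `Q_{Gᵀ}` up to the swap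
`(A×A) ⊕ (B×B) ≃ (B×B) ⊕ (A×A)` of the qubit labels (`QuantumExpanderZSector.lean`), and these lemmas carry
the decoder theorems across that relabelling.

* `flipVec_map_equiv`, `submatrix_mulVec_eq`, `genSupport_submatrix`, `mem_smallSets_submatrix_iff`,
  `syndromeDecrease_submatrix`, `isSSFStep_submatrix_iff`, `ssfHalts_submatrix_iff`, `IsSSFRun.map_equiv`,
  `runOutput_map_equiv`, `isSSFDecoder_comp_equiv` — the procedure;
* `corrects_comp_equiv_iff` — success (with `mem_rowSpace_submatrix_iff` of `HypergraphProductKernels.lean`);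
* `isLocallyStochastic_map_equiv`, `sum_filter_not_corrects_map_equiv` — the noise and the failure weight.

All PROVED (kernel axioms). [folklore] transport statements; the citations point at the sentence they serve.
-/

namespace Literature.InformationTheory.QuantumCodes

open Finset Matrix

section Relabel

variable {Q Q' C R : Type*}

/-- Undoing a relabelling of a finite set. [folklore] -/
private theorem map_symm_map_equiv (e : Q ≃ Q') (F' : Finset Q') :
    (F'.map e.symm.toEmbedding).map e.toEmbedding = F' := by
  ext q
  simp only [Finset.mem_map_equiv, Equiv.symm_symm, Equiv.apply_symm_apply]

/-- Relabelling then undoing it. [folklore] -/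
private theorem map_map_symm_equiv (e : Q ≃ Q') (F : Finset Q) :
    (F.map e.toEmbedding).map e.symm.toEmbedding = F := by
  ext q
  simp only [Finset.mem_map_equiv, Equiv.symm_symm, Equiv.symm_apply_apply]

/-- The indicator vector of a relabelled set is the relabelled indicator vector: `𝟙_{e(F)} = 𝟙_F ∘ e⁻¹`.
[cite: FawziGrospellierLeverrier2018, §2.1 (indicator vectors)] -/
theorem flipVec_map_equiv [DecidableEq Q] [DecidableEq Q'] (e : Q ≃ Q') (F : Finset Q) :
    flipVec (F.map e.toEmbedding) = flipVec F ∘ e.symm := by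
  funext q'
  simp only [flipVec, Function.comp_apply, Finset.mem_map_equiv]

/-- Syndromes are unchanged: `(Hs' ∘ e) x = Hs' (x ∘ e⁻¹)`. [cite: FawziGrospellierLeverrier2018, §2.3 (σ_X(E) = H_X 𝟙_E)] -/
theorem submatrix_mulVec_eq [Fintype Q] [Fintype Q'] (e : Q ≃ Q') (M' : Matrix C Q' (ZMod 2)) (x : Q → ZMod 2) :
    M'.submatrix id e *ᵥ x = M' *ᵥ (x ∘ e.symm) := by
  rw [Matrix.submatrix_mulVec_equiv]; rfl

/-- Syndromes of flips are unchanged. [cite: FawziGrospellierLeverrier2018, §2.3 (σ_X(F))] -/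
theorem submatrix_mulVec_flipVec [Fintype Q] [Fintype Q'] [DecidableEq Q] [DecidableEq Q'] (e : Q ≃ Q') (M' : Matrix C Q' (ZMod 2)) (F : Finset Q) :
    M'.submatrix id e *ᵥ flipVec F = M' *ᵥ flipVec (F.map e.toEmbedding) := by
  rw [submatrix_mulVec_eq, flipVec_map_equiv]

/-- Generator supports are relabelled. [cite: LeverrierTillichZemor2015, §3 eq. (g_ba) (generator = its support)] -/
theorem genSupport_submatrix [Fintype Q] [Fintype Q'] (e : Q ≃ Q') (M' : Matrix R Q' (ZMod 2)) (g : R) :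
    genSupport (M'.submatrix id e) g = (genSupport M' g).map e.symm.toEmbedding := by
  ext q
  simp only [genSupport, Finset.mem_filter, Finset.mem_univ, true_and, Matrix.submatrix_apply, id_eq,
    Finset.mem_map_equiv, Equiv.symm_symm]

/-- Small sets are relabelled: `F ∈ 𝓕(Hg' ∘ e) ↔ e(F) ∈ 𝓕(Hg')`. [cite: FawziGrospellierLeverrier2018, §2.3 (𝓕 := {F ⊆ x : x ∈ 𝒳})] -/
theorem mem_smallSets_submatrix_iff [Fintype Q] [Fintype Q'] [DecidableEq Q] [DecidableEq Q'] [Fintype R] (e : Q ≃ Q') (M' : Matrix R Q' (ZMod 2)) (F : Finset Q) :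
    F ∈ smallSets (M'.submatrix id e) ↔ F.map e.toEmbedding ∈ smallSets M' := by
  simp only [smallSets, Finset.mem_erase, Finset.mem_biUnion, Finset.mem_univ, true_and,
    Finset.mem_powerset, genSupport_submatrix, ne_eq, Finset.map_eq_empty]
  refine and_congr_right fun _ => exists_congr fun g => ?_
  constructor
  · intro h q' hq'
    rw [Finset.mem_map_equiv] at hq'
    have := h hq'
    rwa [Finset.mem_map_equiv, Equiv.symm_symm, Equiv.apply_symm_apply] at this
  · intro h q hq
    rw [Finset.mem_map_equiv, Equiv.symm_symm]
    apply h
    rw [Finset.mem_map_equiv]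
    simpa using hq

/-- The syndrome decrease of a flip is unchanged. [cite: FawziGrospellierLeverrier2018, Algorithm 1 (|σᵢ| − |σᵢ ⊕ σ_X(F)|)] -/
theorem syndromeDecrease_submatrix [Fintype Q] [Fintype Q'] [DecidableEq Q] [DecidableEq Q'] [Fintype C] [DecidableEq C] (e : Q ≃ Q') (Hs' : Matrix C Q' (ZMod 2)) (σ : C → ZMod 2)
    (F : Finset Q) :
    syndromeDecrease (Hs'.submatrix id e) σ F = syndromeDecrease Hs' σ (F.map e.toEmbedding) := by
  simp only [syndromeDecrease, submatrix_mulVec_flipVec]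

/-- Valid steps correspond. [cite: FawziGrospellierLeverrier2018, Algorithms 1–2 (§2.3, §3.2)] -/
theorem isSSFStep_submatrix_iff [Fintype Q] [Fintype Q'] [DecidableEq Q] [DecidableEq Q'] [Fintype C] [DecidableEq C] [Fintype R] (e : Q ≃ Q') (κ : ℝ) (Hs' : Matrix C Q' (ZMod 2))
    (Hg' : Matrix R Q' (ZMod 2)) (σ : C → ZMod 2) (F : Finset Q) :
    IsSSFStep κ (Hs'.submatrix id e) (Hg'.submatrix id e) σ F
      ↔ IsSSFStep κ Hs' Hg' σ (F.map e.toEmbedding) := by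
  simp only [IsSSFStep, mem_smallSets_submatrix_iff, syndromeDecrease_submatrix, Finset.card_map]
  refine and_congr_right fun _ => and_congr_right fun _ => and_congr_right fun _ => ?_
  constructor
  · intro h F' hF'
    have h' := h (F'.map e.symm.toEmbedding) (by rwa [map_symm_map_equiv])
    rwa [map_symm_map_equiv, Finset.card_map] at h'
  · intro h F' hF'
    have h' := h (F'.map e.toEmbedding) hF'
    rwa [Finset.card_map] at h'

/-- Halting syndromes correspond. [cite: FawziGrospellierLeverrier2018, Algorithms 1–2 (while condition)] -/
theorem ssfHalts_submatrix_iff [Fintype Q] [Fintype Q'] [DecidableEq Q] [DecidableEq Q'] [Fintype C] [DecidableEq C] [Fintype R] (e : Q ≃ Q') (κ : ℝ) (Hs' : Matrix C Q' (ZMod 2))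
    (Hg' : Matrix R Q' (ZMod 2)) (σ : C → ZMod 2) :
    SSFHalts κ (Hs'.submatrix id e) (Hg'.submatrix id e) σ ↔ SSFHalts κ Hs' Hg' σ := by
  simp only [SSFHalts, mem_smallSets_submatrix_iff, syndromeDecrease_submatrix]
  constructor
  · intro h F' hF'
    have h' := h (F'.map e.symm.toEmbedding) (by rwa [map_symm_map_equiv])
    rwa [map_symm_map_equiv, Finset.card_map] at h'
  · intro h F hF
    have h' := h (F.map e.toEmbedding) hF
    rwa [Finset.card_map] at h'

/-- A complete valid run for the relabelled problem is, after relabelling its flips, a complete valid run.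
[cite: FawziGrospellierLeverrier2018, Algorithms 1–2 (§2.3, §3.2)] -/
theorem IsSSFRun.map_equiv [Fintype Q] [Fintype Q'] [DecidableEq Q] [DecidableEq Q'] [Fintype C] [DecidableEq C] [Fintype R] (e : Q ≃ Q') {κ : ℝ} {Hs' : Matrix C Q' (ZMod 2)} {Hg' : Matrix R Q' (ZMod 2)}
    {σ : C → ZMod 2} {l : List (Finset Q)}
    (h : IsSSFRun κ (Hs'.submatrix id e) (Hg'.submatrix id e) σ l) :
    IsSSFRun κ Hs' Hg' σ (l.map fun F => F.map e.toEmbedding) := by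
  induction h with
  | halt hh => exact IsSSFRun.halt ((ssfHalts_submatrix_iff e _ _ _ _).1 hh)
  | step hstep _ ih =>
    rw [List.map_cons]
    refine IsSSFRun.step ((isSSFStep_submatrix_iff e _ _ _ _ _).1 hstep) ?_
    rwa [submatrix_mulVec_flipVec] at ih

/-- The output of the relabelled run is the relabelled output. [cite: FawziGrospellierLeverrier2018, Algorithm 1 (Êᵢ₊₁ = Êᵢ ⊕ Fᵢ)] -/
theorem runOutput_map_equiv [DecidableEq Q] [DecidableEq Q'] (e : Q ≃ Q') (l : List (Finset Q)) :
    runOutput (l.map fun F => F.map e.toEmbedding) = runOutput l ∘ e.symm := by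
  induction l with
  | nil => funext q; simp [runOutput]
  | cons F l ih =>
    have hc : ∀ (F' : Finset Q') (l' : List (Finset Q')),
        runOutput (F' :: l') = flipVec F' + runOutput l' := fun _ _ => rfl
    have hc' : ∀ (F' : Finset Q) (l' : List (Finset Q)),
        runOutput (F' :: l') = flipVec F' + runOutput l' := fun _ _ => rfl
    rw [List.map_cons, hc, ih, flipVec_map_equiv, hc']
    rfl

/-- **A small-set-flip decoder for the relabelled problem is (after relabelling its outputs) a small-set-flip
decoder.** [cite: FawziGrospellierLeverrier2018, §3.2 (after Prop. 11: any resolution of the nondeterminism)] -/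
theorem isSSFDecoder_comp_equiv [Fintype Q] [Fintype Q'] [DecidableEq Q] [DecidableEq Q'] [Fintype C] [DecidableEq C] [Fintype R] (e : Q ≃ Q') {κ : ℝ} {Hs' : Matrix C Q' (ZMod 2)} {Hg' : Matrix R Q' (ZMod 2)}
    {D : Decoder (C → ZMod 2) (Q → ZMod 2)}
    (hD : IsSSFDecoder κ (Hs'.submatrix id e) (Hg'.submatrix id e) D) :
    IsSSFDecoder κ Hs' Hg' (fun σ => D σ ∘ e.symm) := by
  intro σ
  obtain ⟨l, hl, hDσ⟩ := hD σ
  refine ⟨l.map fun F => F.map e.toEmbedding, hl.map_equiv e, ?_⟩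
  show D σ ∘ e.symm = _
  rw [hDσ, runOutput_map_equiv]

/-- **Success corresponds**: the relabelled decoder corrects `x ∘ e⁻¹` iff the original corrects `x`.
[cite: Roffe2019, §4.5 (success iff the net operation is a stabilizer)] -/
theorem corrects_comp_equiv_iff [Fintype Q] [Fintype Q'] [Fintype C] [Fintype R] (e : Q ≃ Q') {Hs' : Matrix C Q' (ZMod 2)} {Hg' : Matrix R Q' (ZMod 2)}
    (D : Decoder (C → ZMod 2) (Q → ZMod 2)) (x : Q → ZMod 2) :
    Decoder.Corrects (fun σ => D σ ∘ e.symm) (fun x' => Hs' *ᵥ x') (rowSpace Hg' : Set (Q' → ZMod 2))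
        (x ∘ e.symm)
      ↔ Decoder.Corrects D (fun x => Hs'.submatrix id e *ᵥ x)
          (rowSpace (Hg'.submatrix id e) : Set (Q → ZMod 2)) x := by
  unfold Decoder.Corrects
  simp only [SetLike.mem_coe]
  rw [mem_rowSpace_submatrix_iff, submatrix_mulVec_eq]
  exact Iff.rfl

/-- The relabelled weight `E' ↦ μ(e⁻¹(E'))` is locally stochastic with the same parameter.
[cite: FawziGrospellierLeverrier2018, Def 8 (local stochastic noise)] -/
theorem isLocallyStochastic_map_equiv [Fintype Q] [Fintype Q'] [DecidableEq Q] [DecidableEq Q'] (e : Q ≃ Q') {μ : Finset Q → ℝ} {p : ℝ}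
    (hμ : IsLocallyStochastic μ p) :
    IsLocallyStochastic (fun E' : Finset Q' => μ (E'.map e.symm.toEmbedding)) p := by
  classical
  refine ⟨fun E' => hμ.nonneg _, fun T' => ?_⟩
  have hre : ∑ E' ∈ univ.filter (fun E' : Finset Q' => T' ⊆ E'), μ (E'.map e.symm.toEmbedding)
      = ∑ E ∈ univ.filter (fun E : Finset Q => T'.map e.symm.toEmbedding ⊆ E), μ E := by
    refine Finset.sum_nbij' (fun E' => E'.map e.symm.toEmbedding) (fun E => E.map e.toEmbedding)
      ?_ ?_ ?_ ?_ ?_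
    · intro E' hE'
      rw [Finset.mem_filter] at hE' ⊢
      exact ⟨Finset.mem_univ _, Finset.map_subset_map.2 hE'.2⟩
    · intro E hE
      rw [Finset.mem_filter] at hE ⊢
      refine ⟨Finset.mem_univ _, ?_⟩
      have := (Finset.map_subset_map (f := e.toEmbedding)).2 hE.2
      rwa [map_symm_map_equiv] at this
    · intro E' _; exact map_symm_map_equiv e E'
    · intro E _; exact map_map_symm_equiv e E
    · intro E' _; rfl
  rw [hre]
  have h := hμ.sum_filter_superset_le (T'.map e.symm.toEmbedding)
  rwa [Finset.card_map] at h

open Classical in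
/-- **The failure weight corresponds**: the total weight of the error sets that the original decoder does not
correct (relabelled problem on `Q`) equals the total relabelled weight of the error sets that the relabelled
decoder does not correct (problem on `Q'`). [cite: FawziGrospellierLeverrier2018, Thm 1 (the failure probability)] -/
theorem sum_filter_not_corrects_map_equiv [Fintype Q] [Fintype Q'] [DecidableEq Q] [DecidableEq Q'] [Fintype C] [Fintype R] (e : Q ≃ Q') {Hs' : Matrix C Q' (ZMod 2)}
    {Hg' : Matrix R Q' (ZMod 2)} (D : Decoder (C → ZMod 2) (Q → ZMod 2)) (μ : Finset Q → ℝ) :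
    ∑ E ∈ univ.filter (fun E : Finset Q =>
        ¬ Decoder.Corrects D (fun x => Hs'.submatrix id e *ᵥ x)
            (rowSpace (Hg'.submatrix id e) : Set (Q → ZMod 2)) (flipVec E)), μ E
      = ∑ E' ∈ univ.filter (fun E' : Finset Q' =>
          ¬ Decoder.Corrects (fun σ => D σ ∘ e.symm) (fun x' => Hs' *ᵥ x')
              (rowSpace Hg' : Set (Q' → ZMod 2)) (flipVec E')), μ (E'.map e.symm.toEmbedding) := by
  refine Finset.sum_nbij' (fun E => E.map e.toEmbedding) (fun E' => E'.map e.symm.toEmbedding)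
    ?_ ?_ ?_ ?_ ?_
  · intro E hE
    rw [Finset.mem_filter] at hE ⊢
    refine ⟨Finset.mem_univ _, ?_⟩
    rw [flipVec_map_equiv, corrects_comp_equiv_iff]
    exact hE.2
  · intro E' hE'
    rw [Finset.mem_filter] at hE' ⊢
    refine ⟨Finset.mem_univ _, ?_⟩
    have h := hE'.2
    rw [← map_symm_map_equiv e E', flipVec_map_equiv, corrects_comp_equiv_iff] at h
    exact h
  · intro E _; exact map_map_symm_equiv e E
  · intro E' _; exact map_symm_map_equiv e E'
  · intro E _
    rw [map_map_symm_equiv]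

end Relabel

end Literature.InformationTheory.QuantumCodes
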